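import Summits.PneNP.PneNP.Theorems.PermanentDescentCollapseMakesPermanentEasyIslandDefs
import Literature.Computability.Complexity.CodeFPFinite
import Literature.Computability.Complexity.CodeFPListKit
import HarnessLib

/-!
# Route PermanentDescent, crux `CollapseMakesPermanentEasy` (stmt-PneNP-16142), line `Sketch` — `stub_lineFP`

Registered stub `stub_lineFP` of the skeleton `Cruxes/CollapseMakesPermanentEasy/Lines/Sketch.lean` (idea
`errorless-islands`), over the objects of `Theorems/PermanentDescentCollapseMakesPermanentEasyIslandDefs.lean`
(namespace `Summit.PneNP.PneNP.Theorems.PermIsland`): the line decoder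
`((p, n), ((vs, ls), (m, d))) ↦ lineTry χ p n vs ls m d` is computed on codes in polynomial time when the
island predicate `χ` is. The proof is pure `CodeFP` plumbing (no machine is written), bottom-up along the
definitions:

* `encIsland_codeFP`: the query word IS the code `pairE natE (pairE natE (pairE (rawE natE) natE))` of
  `(p, n, l, v)` (identity string function);
* `linePt_codeFP`: the point `M + c·D` by `zipWith` of `addM`/`mulM` (`modAdd`, `modMul`);
* `certVal_codeFP`: the first certified candidate by `rawFind?` of `χ ∘ encIsland`;
* `certPts_codeFP`: the certified points by a `map` over the parameters `c` (`optMap` tags the value with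
  `c`, `optToList`), then `flatten`;
* `lagrWeight_codeFP`, `lagrAt0_codeFP`: Lagrange interpolation at `0` in residue arithmetic (`map` with an
  `ite` on `natEq`, `modSub`/`modInv`/`modMul`, `modProd`; `map₀ fst` for the nodes, `modSum`);
* `stub_lineFP`: the count test `n + 1 ≤ |certPts|` (`natLength`, `natLe`), `rawTakeNat`, `optSome`, `ite`.
-/

set_option linter.dupNamespace false -- `Summit.PneNP.PneNP.…`: summit = sub-problem name (D-0017 single-conjunct layout)

namespace Summit.PneNP.PneNP.Theorems.PermIsland

open _root_.Computability
open Literature.Computability.Complexity Literature.Computability.Complexity.CodeFP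
  Literature.Computability.Complexity.ModArith

/-- **The island query word is a code**: on the code `pairE natE (pairE natE (pairE (rawE natE) natE))` of
`(p, n, l, v)` the word `encIsland p n l v` is computed by the identity (the two strings coincide).
[cite: AroraBarakCC2009, §1.3] -/
theorem encIsland_codeFP :
    CodeFP (pairE natE (pairE natE (pairE (rawE natE) natE))) strE
      (fun t => encIsland t.1 t.2.1 t.2.2.1 t.2.2.2) :=
  (CodeFP.id _).recodeOut fun _ => rfl

/-- **The line point is polynomial time on codes**: `((p, c), (m, d)) ↦ linePt p c m d`, a `zipWith` of
the residue operation `(a, b) ↦ a + c·b (mod p)`. [cite: AroraBarakCC2009, §1.3] -/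
theorem linePt_codeFP :
    CodeFP (pairE (pairE natE natE) (pairE (rawE natE) (rawE natE))) (rawE natE)
      (fun q => linePt q.1.1 q.1.2 q.2.1 q.2.2) := by
  -- context `r.1 = (p, c)`, items `r.2 = (a, b)`
  let R : (ℕ × ℕ) × (ℕ × ℕ) → List Bool := pairE (pairE natE natE) (pairE natE natE)
  have rp : CodeFP R natE (fun r => r.1.1) := (fst _ _).fst'
  have rc : CodeFP R natE (fun r => r.1.2) := (fst _ _).snd'
  have ra : CodeFP R natE (fun r => r.2.1) := (snd _ _).fst'
  have rb : CodeFP R natE (fun r => r.2.2) := (snd _ _).snd'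
  have rg : CodeFP R natE (fun r => addM r.1.1 r.2.1 (mulM r.1.1 r.1.2 r.2.2)) :=
    modAdd rp ra (modMul rp rc rb)
  exact (zipWith rg).congr fun _ => rfl

/-- **The certified value is polynomial time on codes**: `((p, n), (vs, q)) ↦ certVal χ p n vs q`, a
`find?` over the candidates `vs` of the island predicate `χ` at the query words (`rawFind?`).
[cite: AroraBarakCC2009, §1.3] -/
theorem certVal_codeFP {χ : List Bool → Bool} (hχ : CodeFP strE bitE χ) :
    CodeFP (pairE (pairE natE natE) (pairE (rawE natE) (rawE natE))) (optE natE)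
      (fun q => certVal χ q.1.1 q.1.2 q.2.1 q.2.2) := by
  -- context `r.1 = ((p, n), q)`, item `r.2 = v`
  let R : ((ℕ × ℕ) × List ℕ) × ℕ → List Bool := pairE (pairE (pairE natE natE) (rawE natE)) natE
  have rw : CodeFP R strE (fun r => encIsland r.1.1.1 r.1.1.2 r.1.2 r.2) :=
    (encIsland_codeFP.comp ((fst _ _).fst'.fst'.pair ((fst _ _).fst'.snd'.pair
      ((fst _ _).snd'.pair (snd _ _)))) :)
  exact ((rawFind? (hχ.comp rw)).comp (((fst _ _).pair (snd _ _).snd').pair (snd _ _).fst')).congr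
    fun _ => rfl

/-- **The certified points of the line are polynomial time on codes**:
`((p, n), ((vs, ls), (m, d))) ↦ certPts χ p n vs ls m d`, a `map` over the parameters `c ∈ ls` of
`c ↦ ((certVal χ p n vs (linePt p c m d)).map (c, ·)).toList` (`optMap`, `optToList`) followed by `flatten`.
[cite: AroraBarakCC2009, §1.3] -/
theorem certPts_codeFP {χ : List Bool → Bool} (hχ : CodeFP strE bitE χ) :
    CodeFP (pairE (pairE natE natE) (pairE (pairE (rawE natE) (rawE natE)) (pairE (rawE natE) (rawE natE))))
      (rawE (pairE natE natE)) (fun t => certPts χ t.1.1 t.1.2 t.2.1.1 t.2.1.2 t.2.2.1 t.2.2.2) := by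
  let T : (ℕ × ℕ) × ((List ℕ × List ℕ) × (List ℕ × List ℕ)) → List Bool :=
    pairE (pairE natE natE) (pairE (pairE (rawE natE) (rawE natE)) (pairE (rawE natE) (rawE natE)))
  have hls : CodeFP T (rawE natE) (fun t => t.2.1.2) := (snd _ _).fst'.snd'
  -- context `r.1 = t`, item `r.2 = c`
  let R : ((ℕ × ℕ) × ((List ℕ × List ℕ) × (List ℕ × List ℕ))) × ℕ → List Bool := pairE T natE
  have rpn : CodeFP R (pairE natE natE) (fun r => r.1.1) := (fst _ _).fst'
  have rp : CodeFP R natE (fun r => r.1.1.1) := rpn.fst'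
  have rvs : CodeFP R (rawE natE) (fun r => r.1.2.1.1) := (fst _ _).snd'.fst'.fst'
  have rm : CodeFP R (rawE natE) (fun r => r.1.2.2.1) := (fst _ _).snd'.snd'.fst'
  have rd : CodeFP R (rawE natE) (fun r => r.1.2.2.2) := (fst _ _).snd'.snd'.snd'
  have rc : CodeFP R natE (fun r => r.2) := snd _ _
  have rline : CodeFP R (rawE natE) (fun r => linePt r.1.1.1 r.2 r.1.2.2.1 r.1.2.2.2) :=
    (linePt_codeFP.comp ((rp.pair rc).pair (rm.pair rd)) :)
  have rcert : CodeFP R (optE natE)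
      (fun r => certVal χ r.1.1.1 r.1.1.2 r.1.2.1.1 (linePt r.1.1.1 r.2 r.1.2.2.1 r.1.2.2.2)) :=
    ((certVal_codeFP hχ).comp (rpn.pair (rvs.pair rline)) :)
  have ritem : CodeFP R (rawE (pairE natE natE)) (fun r =>
      ((certVal χ r.1.1.1 r.1.1.2 r.1.2.1.1 (linePt r.1.1.1 r.2 r.1.2.2.1 r.1.2.2.2)).map (Prod.mk r.2)).toList) :=
    ((optToList _).comp ((optMap (CodeFP.id (pairE natE natE))).comp (rc.pair rcert))).congr fun _ => rfl
  exact ((CodeFP.flatten _).comp ((CodeFP.map ritem).comp ((CodeFP.id T).pair hls))).congr fun _ => rfl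

/-- **The Lagrange weight at `0` is polynomial time on codes**: `((p, x), xs) ↦ lagrWeight p xs x`, a
`map` over the nodes `y ∈ xs` of `y ↦ [y = x] ? 1 : y · (y - x)⁻¹ (mod p)` (`natEq`, `modSub`, `modInv`,
`modMul`) followed by the running product `modProd`. [cite: AroraBarakCC2009, §1.3] -/
theorem lagrWeight_codeFP :
    CodeFP (pairE (pairE natE natE) (rawE natE)) natE (fun q => lagrWeight q.1.1 q.2 q.1.2) := by
  -- context `r.1 = (p, x)`, item `r.2 = y`
  let R : (ℕ × ℕ) × ℕ → List Bool := pairE (pairE natE natE) natE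
  have rp : CodeFP R natE (fun r => r.1.1) := (fst _ _).fst'
  have rx : CodeFP R natE (fun r => r.1.2) := (fst _ _).snd'
  have ry : CodeFP R natE (fun r => r.2) := snd _ _
  have rg : CodeFP R natE (fun r =>
      if r.2 = r.1.2 then 1 % r.1.1 else mulM r.1.1 r.2 (invM r.1.1 (subM r.1.1 r.2 r.1.2))) :=
    ((natEq.comp (ry.pair rx)).ite (modOf rp (const _ 1)) (modMul rp ry (modInv rp (modSub rp ry rx)))).congr
      fun r => by simp only [decide_eq_true_eq]
  exact (modProd (fst _ _).fst' (CodeFP.map rg)).congr fun _ => rfl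

/-- **Lagrange interpolation at `0` is polynomial time on codes**: `(p, pts) ↦ lagrAt0 p pts`, a `map` over
the points `(x, y) ∈ pts` of `y · L_x(0) (mod p)` with the node list `pts.map fst` in the context
(`map₀ fst`, `lagrWeight_codeFP`, `modMul`) followed by the running sum `modSum`. [cite: AroraBarakCC2009, §1.3] -/
theorem lagrAt0_codeFP : CodeFP (pairE natE (rawE (pairE natE natE))) natE (fun q => lagrAt0 q.1 q.2) := by
  -- context `r.1 = (p, xs)` with `xs = pts.map fst`, item `r.2 = (x, y)`
  let R : (ℕ × List ℕ) × (ℕ × ℕ) → List Bool := pairE (pairE natE (rawE natE)) (pairE natE natE)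
  have rp : CodeFP R natE (fun r => r.1.1) := (fst _ _).fst'
  have rxs : CodeFP R (rawE natE) (fun r => r.1.2) := (fst _ _).snd'
  have rx : CodeFP R natE (fun r => r.2.1) := (snd _ _).fst'
  have ry : CodeFP R natE (fun r => r.2.2) := (snd _ _).snd'
  have rw : CodeFP R natE (fun r => lagrWeight r.1.1 r.1.2 r.2.1) :=
    (lagrWeight_codeFP.comp ((rp.pair rx).pair rxs) :)
  have rg : CodeFP R natE (fun r => mulM r.1.1 r.2.2 (lagrWeight r.1.1 r.1.2 r.2.1)) := modMul rp ry rw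
  have hctx : CodeFP (pairE natE (rawE (pairE natE natE))) (pairE natE (rawE natE))
      (fun q => (q.1, q.2.map Prod.fst)) := (fst _ _).pair ((map₀ (fst natE natE)).comp (snd _ _))
  exact (modSum (fst _ _) ((CodeFP.map rg).comp (hctx.pair (snd _ _)))).congr fun _ => rfl

/-- **Stub LF (the line decoder is polynomial time; machine level).** On the code of
`((p, n), ((vs, ls), (m, d)))`, `lineTry χ p n vs ls m d` is computed in polynomial time when the island
predicate `χ` is: the certified points (`certPts_codeFP`), the count test `n + 1 ≤ |certPts|` (`natLength`,
`natLe`), the first `n + 1` points (`rawTakeNat`), their interpolation at `0` (`lagrAt0_codeFP`), `some`/`none`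
by an `ite` — closure of polynomial time under composition and bounded loops, assembled from typed `CodeFP`
combinators. [cite: AroraBarakCC2009, §1.3] -/
theorem stub_lineFP :
    ∀ χ : List Bool → Bool, CodeFP strE bitE χ →
      CodeFP (pairE (pairE natE natE) (pairE (pairE (rawE natE) (rawE natE)) (pairE (rawE natE) (rawE natE))))
        (optE natE) (fun t => lineTry χ t.1.1 t.1.2 t.2.1.1 t.2.1.2 t.2.2.1 t.2.2.2) := by
  intro χ hχ
  let T : (ℕ × ℕ) × ((List ℕ × List ℕ) × (List ℕ × List ℕ)) → List Bool :=
    pairE (pairE natE natE) (pairE (pairE (rawE natE) (rawE natE)) (pairE (rawE natE) (rawE natE)))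
  have hp : CodeFP T natE (fun t => t.1.1) := (fst _ _).fst'
  have hn1 : CodeFP T natE (fun t => t.1.2 + 1) := natAdd.comp ((fst _ _).snd'.pair (const _ 1))
  have hcert : CodeFP T (rawE (pairE natE natE))
      (fun t => certPts χ t.1.1 t.1.2 t.2.1.1 t.2.1.2 t.2.2.1 t.2.2.2) := certPts_codeFP hχ
  have hcnt : CodeFP T natE (fun t => (certPts χ t.1.1 t.1.2 t.2.1.1 t.2.1.2 t.2.2.1 t.2.2.2).length) :=
    (natLength _).comp hcert
  have htest : CodeFP T bitE
      (fun t => decide (t.1.2 + 1 ≤ (certPts χ t.1.1 t.1.2 t.2.1.1 t.2.1.2 t.2.2.1 t.2.2.2).length)) :=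
    natLe.comp (hn1.pair hcnt)
  have htake : CodeFP T (rawE (pairE natE natE))
      (fun t => (certPts χ t.1.1 t.1.2 t.2.1.1 t.2.1.2 t.2.2.1 t.2.2.2).take (t.1.2 + 1)) :=
    (rawTakeNat _).comp (hn1.pair hcert)
  have hsome : CodeFP T (optE natE)
      (fun t => some (lagrAt0 t.1.1 ((certPts χ t.1.1 t.1.2 t.2.1.1 t.2.1.2 t.2.2.1 t.2.2.2).take (t.1.2 + 1)))) :=
    (optSome natE).comp (lagrAt0_codeFP.comp (hp.pair htake))
  exact (htest.ite hsome (const _ none)).congr fun t => by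
    simp only [lineTry, decide_eq_true_eq]

end Summit.PneNP.PneNP.Theorems.PermIsland
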